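import Summits.AtomisticToContinuum.Crystallization.Theorems.PhononSlackCertificatesPeriodicGivenLayeredConvexity3

/-!
# Increment convexity of the alternating block energy, VI: the analytic regime and the span series

Helper for stub `stub_convexity` of line `Sketch` of crux `PeriodicGivenLayered`
(stmt-AtomisticToContinuum-11779). For spans `k ≥ 4` the scaled curvature of every site is bounded by
`(141/20)(P + T)⁻⁴` (`T = (39k/50)² ≥ 15/2`); this file certifies the lattice sum
`∑_{ℤ²} (141/20)(P+T)⁻⁴ ≤ (141/20)(9T⁻⁴ + (64/21)T⁻³)` (box `[-1,1]²` plus square-shell tail from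
`…Convexity3`) and the span series `∑_{4 ≤ k ≤ n} k² (141/20)(9 T_k⁻⁴ + (64/21) T_k⁻³) ≤ 2683/2500`
(telescoping partial sums of `k⁻⁶`, `k⁻⁴` from `k = 5`, the `k = 4` term exactly). [folklore]
-/

noncomputable section

namespace Summit.AtomisticToContinuum.Crystallization.Theorems.LayeredHull

open Finset

/-! ## The analytic regime (`k ≥ 4`) -/

/-- **Lattice sum in the analytic regime**: for `T ≥ 15/2`,
`∑_{ℤ²} (141/20)(P + T)⁻⁴ ≤ (141/20)(9 T⁻⁴ + (64/21) T⁻³)` (box `[-1,1]²`: nine sites with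
`P ≥ 0`; tail from `r ≥ 2`). [folklore] -/
theorem cvx_tsum_analytic (δ : ℤ) (hδ : δ = 0 ∨ δ = 1) (T : ℝ) (hT : 15 / 2 ≤ T) :
    (Summable fun p : ℤ × ℤ => 141 / 20 * (((((p.1 : ℝ) + p.2 / 2 + δ / 2) ^ 2 + 3 / 4 * ((p.2 : ℝ) + δ / 3) ^ 2) + T)⁻¹) ^ 4) ∧
    ∑' p : ℤ × ℤ, 141 / 20 * (((((p.1 : ℝ) + p.2 / 2 + δ / 2) ^ 2 + 3 / 4 * ((p.2 : ℝ) + δ / 3) ^ 2) + T)⁻¹) ^ 4 ≤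
      141 / 20 * (9 * (T⁻¹) ^ 4 + 64 / 21 * (T⁻¹) ^ 3) := by
  set Pf : ℤ × ℤ → ℝ := fun p => (((p.1 : ℝ) + p.2 / 2 + δ / 2) ^ 2 + 3 / 4 * ((p.2 : ℝ) + δ / 3) ^ 2) with hPf
  have hP0 : ∀ p, 0 ≤ Pf p := fun p => by rw [hPf]; positivity
  have hT0 : 0 < T := by linarith
  have key := cvx_lattice_tsum_le (F := fun p => 141 / 20 * ((Pf p + T)⁻¹) ^ 4)
    (fun p => by positivity) (N := 1) (n := 3) le_rfl (by norm_num)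
    (show (0 : ℝ) ≤ 141 / 20 by norm_num) hT0 (by
      intro p hp
      have hr1 : 1 ≤ max |p.1| |p.2| := by omega
      have hshell := cvx_P_ge_shell δ hδ p hr1
      have hmono : ((Pf p + T)⁻¹) ^ 4 ≤
          ((3 / 4 * (((max |p.1| |p.2| : ℤ) : ℝ) - 1 / 3) ^ 2 + T)⁻¹) ^ 4 := by
        apply pow_le_pow_left₀ (by positivity)
        exact inv_anti₀ (by positivity) (by rw [hPf]; linarith)
      exact mul_le_mul_of_nonneg_left hmono (by norm_num))
  obtain ⟨hsum, hle⟩ := key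
  refine ⟨hsum, hle.trans ?_⟩
  -- the nine box terms
  have hbox : ∑ p ∈ Icc (-((1 : ℕ) : ℤ)) (1 : ℕ) ×ˢ Icc (-((1 : ℕ) : ℤ)) (1 : ℕ),
      141 / 20 * ((Pf p + T)⁻¹) ^ 4 ≤ 9 * (141 / 20 * (T⁻¹) ^ 4) := by
    have hterm : ∀ p ∈ Icc (-((1 : ℕ) : ℤ)) (1 : ℕ) ×ˢ Icc (-((1 : ℕ) : ℤ)) (1 : ℕ),
        141 / 20 * ((Pf p + T)⁻¹) ^ 4 ≤ 141 / 20 * (T⁻¹) ^ 4 := by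
      intro p _
      have : (Pf p + T)⁻¹ ≤ T⁻¹ := inv_anti₀ hT0 (by linarith [hP0 p])
      have h4 : ((Pf p + T)⁻¹) ^ 4 ≤ (T⁻¹) ^ 4 := pow_le_pow_left₀ (by positivity) this 4
      linarith
    have := Finset.sum_le_card_nsmul _ _ _ hterm
    rw [cvx_card_box, nsmul_eq_mul] at this
    simpa using this
  -- the tail
  have htail : ((3 / 4 * (((1 : ℕ) : ℝ) - 1 / 3) ^ 2 + T)⁻¹) ^ 3 ≤ (T⁻¹) ^ 3 := by
    apply pow_le_pow_left₀ (by positivity)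
    exact inv_anti₀ hT0 (by norm_num)
  have hT3 : 0 ≤ (T⁻¹) ^ 3 := by positivity
  have e : (32 : ℝ) * (((1 : ℕ) : ℝ) + 1) / ((3 : ℕ) * (6 * ((1 : ℕ) : ℝ) + 1)) = 64 / 21 := by norm_num
  rw [e]
  nlinarith [htail, hbox]

/-! ## The span series -/

/-- Telescoping bound for partial sums of inverse powers:
`∑_{m < k ≤ n} k^{-(e+1)} ≤ e⁻¹ m⁻ᵉ` (`m ≥ 1`). [folklore] -/
theorem cvx_sum_inv_pow_le (m e : ℕ) (hm : 1 ≤ m) (he : 1 ≤ e) (n : ℕ) :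
    ∑ k ∈ Finset.Icc (m + 1) n, ((k : ℝ)⁻¹) ^ (e + 1) ≤ (e : ℝ)⁻¹ * ((m : ℝ)⁻¹) ^ e := by
  have hme : 0 < (e : ℝ) := by exact_mod_cast he
  -- strengthened invariant for `n ≥ m`
  have hinv : ∀ n, m ≤ n → ∑ k ∈ Finset.Icc (m + 1) n, ((k : ℝ)⁻¹) ^ (e + 1) ≤
      (e : ℝ)⁻¹ * (((m : ℝ)⁻¹) ^ e - ((n : ℝ)⁻¹) ^ e) := by
    intro n hn
    induction n, hn using Nat.le_induction with
    | base => simp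
    | succ n hmn ih =>
      rw [Finset.sum_Icc_succ_top (by omega)]
      have hn0 : (0 : ℝ) < n := by exact_mod_cast (show 0 < n by omega)
      have hstep := cvx_inv_pow_sub_inv_pow hn0 (by linarith : (n : ℝ) ≤ (n : ℝ) + 1) e
      have hterm : (((n : ℝ) + 1)⁻¹) ^ (e + 1) ≤
          (e : ℝ)⁻¹ * (((n : ℝ)⁻¹) ^ e - (((n : ℝ) + 1)⁻¹) ^ e) := by
        rw [le_inv_mul_iff₀ hme]
        simpa using hstep
      push_cast
      linarith
  rcases le_or_gt m n with h | h
  · have := hinv n h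
    have hpos : 0 ≤ (e : ℝ)⁻¹ * ((n : ℝ)⁻¹) ^ e := by positivity
    nlinarith
  · rw [Finset.Icc_eq_empty (by omega), Finset.sum_empty]
    positivity

/-- **The span series is bounded**: `∑_{4 ≤ k ≤ n} k² · (141/20)(9 T_k⁻⁴ + (64/21) T_k⁻³) ≤ 2683/2500`
with `T_k = (39k/50)²`. [folklore] -/
theorem cvx_series_bound (n : ℕ) :
    ∑ k ∈ Finset.Icc 4 n, (k : ℝ) ^ 2 * (141 / 20 * (9 * (((39 / 50 * (k : ℝ)) ^ 2)⁻¹) ^ 4 +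
      64 / 21 * (((39 / 50 * (k : ℝ)) ^ 2)⁻¹) ^ 3)) ≤ 2683 / 2500 := by
  have hterm : ∀ k ∈ Finset.Icc 4 n, (k : ℝ) ^ 2 * (141 / 20 * (9 * (((39 / 50 * (k : ℝ)) ^ 2)⁻¹) ^ 4 +
      64 / 21 * (((39 / 50 * (k : ℝ)) ^ 2)⁻¹) ^ 3)) =
      141 / 20 * 9 * (50 / 39) ^ 8 * ((k : ℝ)⁻¹) ^ (5 + 1) +
        141 / 20 * (64 / 21) * (50 / 39) ^ 6 * ((k : ℝ)⁻¹) ^ (3 + 1) := by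
    intro k hk
    rw [Finset.mem_Icc] at hk
    have hk0 : (k : ℝ) ≠ 0 := by exact_mod_cast (show k ≠ 0 by omega)
    simp only [inv_pow]
    field_simp
    ring
  rw [Finset.sum_congr rfl hterm, Finset.sum_add_distrib, ← Finset.mul_sum, ← Finset.mul_sum]
  -- peel off `k = 4` and telescope from `k = 5`
  have h6 : ∑ k ∈ Finset.Icc 4 n, ((k : ℝ)⁻¹) ^ (5 + 1) ≤
      ((4 : ℝ)⁻¹) ^ (5 + 1) + (5 : ℝ)⁻¹ * ((4 : ℝ)⁻¹) ^ 5 := by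
    rcases le_or_gt 4 n with h | h
    · rw [← Finset.insert_Icc_add_one_left_eq_Icc h, Finset.sum_insert (by simp)]
      have := cvx_sum_inv_pow_le 4 5 (by norm_num) (by norm_num) n
      push_cast at this ⊢
      linarith
    · rw [Finset.Icc_eq_empty (by omega), Finset.sum_empty]
      positivity
  have h4 : ∑ k ∈ Finset.Icc 4 n, ((k : ℝ)⁻¹) ^ (3 + 1) ≤
      ((4 : ℝ)⁻¹) ^ (3 + 1) + (3 : ℝ)⁻¹ * ((4 : ℝ)⁻¹) ^ 3 := by
    rcases le_or_gt 4 n with h | h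
    · rw [← Finset.insert_Icc_add_one_left_eq_Icc h, Finset.sum_insert (by simp)]
      have := cvx_sum_inv_pow_le 4 3 (by norm_num) (by norm_num) n
      push_cast at this ⊢
      linarith
    · rw [Finset.Icc_eq_empty (by omega), Finset.sum_empty]
      positivity
  have c6 : (0 : ℝ) ≤ 141 / 20 * 9 * (50 / 39) ^ 8 := by positivity
  have c4 : (0 : ℝ) ≤ 141 / 20 * (64 / 21) * (50 / 39) ^ 6 := by positivity
  calc 141 / 20 * 9 * (50 / 39) ^ 8 * ∑ k ∈ Finset.Icc 4 n, ((k : ℝ)⁻¹) ^ (5 + 1) +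
        141 / 20 * (64 / 21) * (50 / 39) ^ 6 * ∑ k ∈ Finset.Icc 4 n, ((k : ℝ)⁻¹) ^ (3 + 1)
      ≤ 141 / 20 * 9 * (50 / 39) ^ 8 * (((4 : ℝ)⁻¹) ^ (5 + 1) + (5 : ℝ)⁻¹ * ((4 : ℝ)⁻¹) ^ 5) +
        141 / 20 * (64 / 21) * (50 / 39) ^ 6 *
          (((4 : ℝ)⁻¹) ^ (3 + 1) + (3 : ℝ)⁻¹ * ((4 : ℝ)⁻¹) ^ 3) :=
        add_le_add (mul_le_mul_of_nonneg_left h6 c6) (mul_le_mul_of_nonneg_left h4 c4)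
    _ ≤ 2683 / 2500 := by norm_num

end Summit.AtomisticToContinuum.Crystallization.Theorems.LayeredHull

end
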